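import Literature.Probability.RandomPlanarGeometry.HexSAWSurfaceWallRateSqrtMonotone
import Literature.Probability.RandomPlanarGeometry.HexSAWSurfaceSqrtAsymptotic
import Literature.Probability.RandomPlanarGeometry.HexSAWSurfaceSqrtStrict
import Mathlib.Analysis.Convex.Deriv
import HarnessLib

/-!
# Honeycomb SAW at the ZIG-ZAG surface (BBdGDCG 2014): the one-sided SURFACE DENSITIES `ρ⁻(t) ≤ ρ⁺(t)` of the wall-bridge free energy
# `κ(t) = log β(eᵗ)` — window `[0, ½]`, SATURATION `ρ±(t) → ½` with an explicit deficit, and STRICTNESS (no chord of slope `½`: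
# `β(y') < √(y'/y) β(y)`, `ρ⁺(t) < ½` at every `t`) — edition 2: stated for `β(y)` only (door-free)

Topic `Literature/Probability/RandomPlanarGeometry` (lane «pcv-sawmu»; the ZIG-ZAG-frame twin of EDITION 7 of
`HexSAWArmchairWallRateSqrtMonotone.lean` (Beaton's rotated = armchair frame), assembled over the zig-zag files
`HexSAWSurfaceWallRateSqrtMonotone.lean` (a-p5 g12: `Wall.convexOn_log_wallRate_exp`, `log_wallRate_sub_log_wallRate_mem_Icc`,
`antitoneOn_wallRate_div_sqrt`, `mul_deriv_wallRate_le_half`), `HexSAWSurfaceSqrtAsymptotic.lean` (a-p6 g11: `one_le_wallRate_div_sqrt`,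
the window `wallRate_le_sqrt_div : 36² < y → β(y) ≤ √y/(1 − 36/√y)`, `tendsto_log_wallRate_sub_half_log`), `HexSAWSurfaceSqrtStrict.lean`
(a-p6 g11: `sqrt_lt_wallRate : √y < β(y)`)).  (Edition 1 also imported `HexSAWSurfaceWallRateEq.lean` — `wallRate_eq_surfaceMu : β(y) = μ(y)`
for every `y > 0` — to restate the results for BBdGDCG's `μ(y)`; that module has no olean yet, so EDITION 2 drops the import and the six
`surfaceMu` restatements (the transfer is one `rw [wallRate_eq_surfaceMu]` per statement, for a later module).)  Here `β(y) = wallRate y`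
is the growth rate of the zig-zag wall bridges and `μ(y) = surfaceMu y` is BBdGDCG's
half-plane surface growth rate (`HexSAWSurfaceYcLimitAllY.lean`, `= lim_n C⁺_n(y)^{1/n}` for every `y > 0`).

Sources.  N. R. Beaton, M. Bousquet-Mélou, J. de Gier, H. Duminil-Copin, A. J. Guttmann, *The critical fugacity for surface adsorption of
self-avoiding walks on the honeycomb lattice is `1 + √2`*, Comm. Math. Phys. 326 (2014) 727 = arXiv:1109.0358v5, §3.1, Proposition 5
(p. 9: "`μ(y)` … is a log-convex, non-decreasing function of `log y`, and therefore continuous and almost everywhere differentiable … `μ(y) ≥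
max(μ, √y)`") and the remarks after it (p. 10: "This translates into `μ(y) ∼ √y` in our honeycomb setting"; the density remark and footnote 4);
J. M. Hammersley, G. M. Torrie, S. G. Whittington, J. Phys. A 15 (1982) 539, §2; E. J. Janse van Rensburg, S. G. Whittington, J. Phys. A 46
(2013) 435003, §3.1 eq. (3.4) (the hypercubic left/right densities `𝓔_±`).

## What is proved (namespace `Literature.Probability.RandomPlanarGeometry.SAW.HexBW.Wall`, then `…SAW.HV`; no hypotheses beyond `0 < y`)

* vocabulary `wallFreeEnergy t = κ(t) := log β(eᵗ)`, `wallRightDensity t = ρ⁺(t) := d⁺κ/dt`, `wallLeftDensity t = ρ⁻(t) := d⁻κ/dt`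
  (Mathlib one-sided `derivWithin`); `hasDerivWithinAt_wallRightDensity` / `…Left…`, `wallDensities_mem_Icc` (`0 ≤ ρ⁻ ≤ ρ⁺ ≤ ½`),
  `monotone_wallRightDensity` / `…Left…`, interlacing `wallRightDensity_le_wallLeftDensity_of_lt`, chord sandwich, the density identity
  `wallRightDensity_eq_of_differentiableAt` (`ρ±(t) = y β'(y)/β(y)` where `β` is differentiable at `y = eᵗ`);
* free-energy window `half_le_wallFreeEnergy` (`t/2 ≤ κ(t)`), `wallFreeEnergy_sub_half_le` (`κ(t) − t/2 ≤ 72 e^{−t/2}` for `t ≥ 2 log 72`),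
  `tendsto_wallFreeEnergy_sub_half`;
* SATURATION: **`half_sub_le_wallLeftDensity : 2 + 2 log 72 ≤ t → ½ − 36e·e^{−t/2} ≤ ρ⁻(t)`**, **`tendsto_wallLeftDensity_atTop`,
  `tendsto_wallRightDensity_atTop` (`ρ±(t) → ½`)** — at large fugacity one vertex in two of a long zig-zag wall bridge is on the wall;
* STRICTNESS (three-chord argument + `√y < β(y)` + `β/√y → 1`): **`slope_wallFreeEnergy_lt_half`**, `wallFreeEnergy_sub_lt`,
  **`wallRate_lt_sqrt_div_mul : 0 < y < y' → β(y') < √(y'/y)·β(y)`**, `strictAntiOn_wallRate_div_sqrt`, **`wallRightDensity_lt_half :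
  ρ⁺(t) < ½` at every `t`**, `wallLeftDensity_lt_half`;
* (edition 1 only, dropped here) the verbatim transfer to BBdGDCG's `μ(y) = β(y)` via `wallRate_eq_surfaceMu`.
EDITIONS: ed.1 9e4262b60a555491 (a-p6 g13; CLASS D on four oleans); ed.2 (this, a-p6 g14) = ed.1 with the import of
`HexSAWSurfaceWallRateEq` and the final `namespace …SAW.HV` block (six `surfaceMu` restatements) removed — every other byte unchanged;
CLASS S on `HexSAWSurfaceWallRateSqrtMonotone` (olean 10:33Z), `HexSAWSurfaceSqrtAsymptotic` + `HexSAWSurfaceSqrtStrict` (oleans 15:04Z).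

LABEL (author's proposal, as for the armchair twin): vocabulary/window/monotone/interlacing = CONSOLIDATION AS PRINTED XS (Prop. 5's
convexity clauses in the Janse van Rensburg–Whittington density wording); saturation-with-rate = lane corollary S, NEW-IN-WRITING (modest);
strictness = lane corollaries XS–S, NEW-IN-WRITING (modest).  Wording guards: `½` is the zig-zag wall's geometric ceiling, a LARGE-fugacity
statement; nothing is claimed at or near `y_c = 1 + √2` nor about the order of the transition; `36`, `72`, `2 + 2 log 72` are the tree's
certificate constants, not optimal.  Lane «pcv-sawmu», seat a-p6 g13 (author; filer = the seat holding a slot when the three wall-frame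
oleans serve).
-/

noncomputable section

open Finset Filter Function
open Literature.Probability.LatticeModels Literature.Probability.Percolation SimpleGraph
open _root_.Topology

namespace Literature.Probability.RandomPlanarGeometry.SAW.HexBW.Wall

open HV

variable {y : ℝ}

/-! ### «WALL-SURFACE-DENSITY» — the one-sided SURFACE DENSITIES `ρ⁻(t) ≤ ρ⁺(t)` of the zig-zag free energy `κ(t) = log β(eᵗ)` as
functions of `t = log y`: window `[0, ½]`, monotone and interlacing (convexity), the density identity at points of
differentiability, and SATURATION — `ρ±(t) → ½` as `t → ∞` with the explicit deficit `½ − 36e·e^{−t/2} ≤ ρ⁻(t)` for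
`t ≥ 2 + 2 log 72`: at large fugacity one vertex in two of a long zig-zag (BBdGDCG) wall bridge lies on the wall, the most the
zig-zag boundary allows -/

/-- **`κ(t) := log β(eᵗ)`**, the zig-zag wall-bridge free energy as a function of `t = log y` — a convex function
(`convexOn_log_wallRate_exp`) whose one-sided derivatives are the densities of adsorbed vertices.
[cite: BeatonBousquetMelouDeGierDuminilCopinGuttmann2014, §3.1, Proposition 5 (arXiv v5 p. 9: "log-convex, non-decreasing function of log y"); HammersleyTorrieWhittington1982, §2] -/
def wallFreeEnergy (t : ℝ) : ℝ := Real.log (wallRate (Real.exp t))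

/-- **`ρ⁺(t) := d⁺κ/dt (t)`**, the RIGHT density of adsorbed vertices of zig-zag (BBdGDCG) wall bridges at fugacity `y = eᵗ` (the right
derivative of the convex free energy; it exists at every `t`, `hasDerivWithinAt_wallRightDensity`). The hypercubic analogue is
the right-density `𝓔_+(a) = a d⁺κ/da` of Janse van Rensburg–Whittington.
[cite: BeatonBousquetMelouDeGierDuminilCopinGuttmann2014, §3.1, Proposition 5 (arXiv v5 p. 9: "almost everywhere differentiable"); JansevanRensburgWhittington2013, §3.1 eq. (3.4) (arXiv v4 p. 6: hypercubic analogue)] -/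
def wallRightDensity (t : ℝ) : ℝ := derivWithin wallFreeEnergy (Set.Ioi t) t

/-- **`ρ⁻(t) := d⁻κ/dt (t)`**, the LEFT density of adsorbed vertices of zig-zag (BBdGDCG) wall bridges at fugacity `y = eᵗ`.
[cite: BeatonBousquetMelouDeGierDuminilCopinGuttmann2014, §3.1, Proposition 5 (arXiv v5 p. 9); JansevanRensburgWhittington2013, §3.1 eq. (3.4) (arXiv v4 p. 6: hypercubic analogue)] -/
def wallLeftDensity (t : ℝ) : ℝ := derivWithin wallFreeEnergy (Set.Iio t) t

/-- `κ(t) = log β(eᵗ)` (unfolding). [cite: BeatonBousquetMelouDeGierDuminilCopinGuttmann2014, §3.1, Proposition 5 (arXiv v5 p. 9)] -/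
theorem wallFreeEnergy_apply (t : ℝ) : wallFreeEnergy t = Real.log (wallRate (Real.exp t)) := rfl

/-- **`κ` is convex on `ℝ`** (= `convexOn_log_wallRate_exp`, Proposition 7's "log-convex … function of log y" for `β`).
[cite: BeatonBousquetMelouDeGierDuminilCopinGuttmann2014, §3.1, Proposition 5 (arXiv v5 p. 9); HammersleyTorrieWhittington1982, §2] -/
theorem convexOn_wallFreeEnergy : ConvexOn ℝ Set.univ wallFreeEnergy := convexOn_log_wallRate_exp

/-- `0 ≤ κ(t') − κ(t) ≤ (t' − t)/2` for `t ≤ t'` (= `log_wallRate_sub_log_wallRate_mem_Icc` in the variable `t = log y`).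
[cite: BeatonBousquetMelouDeGierDuminilCopinGuttmann2014, §3.1, Proposition 5 (arXiv v5 p. 9: "non-decreasing")] -/
theorem wallFreeEnergy_sub_mem_Icc {t t' : ℝ} (htt' : t ≤ t') :
    wallFreeEnergy t' - wallFreeEnergy t ∈ Set.Icc (0 : ℝ) ((t' - t) / 2) := by
  have h := log_wallRate_sub_log_wallRate_mem_Icc (Real.exp_pos t) (Real.exp_le_exp.2 htt')
  rwa [Real.log_exp, Real.log_exp] at h

/-- Every chord of `κ` has slope in `[0, ½]`. [cite: BeatonBousquetMelouDeGierDuminilCopinGuttmann2014, §3.1, Proposition 5 (arXiv v5 p. 9)] -/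
theorem slope_wallFreeEnergy_mem_Icc {t t' : ℝ} (h : t < t') : slope wallFreeEnergy t t' ∈ Set.Icc (0 : ℝ) (1 / 2) := by
  obtain ⟨h0, h1⟩ := wallFreeEnergy_sub_mem_Icc h.le
  have hpos : 0 < t' - t := sub_pos.2 h
  rw [slope_def_field]
  exact ⟨div_nonneg h0 hpos.le, (div_le_iff₀ hpos).2 (by linarith)⟩

/-- **`ρ⁺(t)` IS the right derivative of `κ` at `t`** (it exists at every `t`, by convexity).
[cite: BeatonBousquetMelouDeGierDuminilCopinGuttmann2014, §3.1, Proposition 5 (arXiv v5 p. 9); JansevanRensburgWhittington2013, §3.1 eq. (3.4) (arXiv v4 p. 6: «These exist for every finite a > 0 since κ(a) is a convex function of log a»)] -/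
theorem hasDerivWithinAt_wallRightDensity (t : ℝ) :
    HasDerivWithinAt wallFreeEnergy (wallRightDensity t) (Set.Ioi t) t :=
  convexOn_wallFreeEnergy.hasDerivWithinAt_rightDeriv_of_mem_interior (by simp)

/-- **`ρ⁻(t)` IS the left derivative of `κ` at `t`.**
[cite: BeatonBousquetMelouDeGierDuminilCopinGuttmann2014, §3.1, Proposition 5 (arXiv v5 p. 9); JansevanRensburgWhittington2013, §3.1 eq. (3.4) (arXiv v4 p. 6)] -/
theorem hasDerivWithinAt_wallLeftDensity (t : ℝ) :
    HasDerivWithinAt wallFreeEnergy (wallLeftDensity t) (Set.Iio t) t :=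
  convexOn_wallFreeEnergy.hasDerivWithinAt_leftDeriv_of_mem_interior (by simp)

/-- **`ρ⁻(t) ≤ ρ⁺(t)`** at every `t`. [cite: BeatonBousquetMelouDeGierDuminilCopinGuttmann2014, §3.1, Proposition 5 (arXiv v5 p. 9); JansevanRensburgWhittington2013, §3.1 eq. (3.4) (arXiv v4 p. 6: «𝓔_-(a) ≤ 𝓔_+(a)»)] -/
theorem wallLeftDensity_le_wallRightDensity (t : ℝ) : wallLeftDensity t ≤ wallRightDensity t :=
  convexOn_wallFreeEnergy.leftDeriv_le_rightDeriv_of_mem_interior (by simp)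

/-- **`ρ⁺` is non-decreasing.** [cite: BeatonBousquetMelouDeGierDuminilCopinGuttmann2014, §3.1, Proposition 5 (arXiv v5 p. 9: "log-convex"); JansevanRensburgWhittington2013, §3.1 (arXiv v4 p. 6: «monotone functions»)] -/
theorem monotone_wallRightDensity : Monotone wallRightDensity := by
  intro t t' h
  have := convexOn_wallFreeEnergy.monotoneOn_rightDeriv (by simp : t ∈ interior (Set.univ : Set ℝ)) (by simp) h
  simpa [wallRightDensity] using this

/-- **`ρ⁻` is non-decreasing.** [cite: BeatonBousquetMelouDeGierDuminilCopinGuttmann2014, §3.1, Proposition 5 (arXiv v5 p. 9: "log-convex"); JansevanRensburgWhittington2013, §3.1 (arXiv v4 p. 6)] -/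
theorem monotone_wallLeftDensity : Monotone wallLeftDensity := by
  intro t t' h
  have := convexOn_wallFreeEnergy.monotoneOn_leftDeriv (by simp : t ∈ interior (Set.univ : Set ℝ)) (by simp) h
  simpa [wallLeftDensity] using this

/-- `ρ⁺(t) ≤ (κ(t') − κ(t))/(t' − t)` for `t < t'`. [cite: BeatonBousquetMelouDeGierDuminilCopinGuttmann2014, §3.1, Proposition 5 (arXiv v5 p. 9: "log-convex")] -/
theorem wallRightDensity_le_slope {t t' : ℝ} (h : t < t') : wallRightDensity t ≤ slope wallFreeEnergy t t' :=
  convexOn_wallFreeEnergy.rightDeriv_le_slope_of_mem_interior (by simp) (Set.mem_univ t') h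

/-- `(κ(t') − κ(t))/(t' − t) ≤ ρ⁻(t')` for `t < t'`. [cite: BeatonBousquetMelouDeGierDuminilCopinGuttmann2014, §3.1, Proposition 5 (arXiv v5 p. 9: "log-convex")] -/
theorem slope_le_wallLeftDensity {t t' : ℝ} (h : t < t') : slope wallFreeEnergy t t' ≤ wallLeftDensity t' :=
  convexOn_wallFreeEnergy.slope_le_leftDeriv_of_mem_interior (Set.mem_univ t) (by simp) h

/-- **The one-sided densities interlace: `ρ⁺(t) ≤ ρ⁻(t')` for `t < t'`.** [cite: BeatonBousquetMelouDeGierDuminilCopinGuttmann2014, §3.1, Proposition 5 (arXiv v5 p. 9: "log-convex")] -/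
theorem wallRightDensity_le_wallLeftDensity_of_lt {t t' : ℝ} (h : t < t') : wallRightDensity t ≤ wallLeftDensity t' :=
  (wallRightDensity_le_slope h).trans (slope_le_wallLeftDensity h)

/-- **`0 ≤ ρ⁻(t)`.** [cite: BeatonBousquetMelouDeGierDuminilCopinGuttmann2014, §3.1, Proposition 5 (arXiv v5 p. 9: "non-decreasing")] -/
theorem wallLeftDensity_nonneg (t : ℝ) : 0 ≤ wallLeftDensity t :=
  (slope_wallFreeEnergy_mem_Icc (sub_one_lt t)).1.trans (slope_le_wallLeftDensity (sub_one_lt t))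

/-- **`ρ⁺(t) ≤ ½`** — at most one vertex in two of an zig-zag (BBdGDCG) wall bridge is a wall vertex, in density.
[cite: BeatonBousquetMelouDeGierDuminilCopinGuttmann2014, §3.1, Proposition 5 (arXiv v5 p. 9: "μ(y) ≥ max{μ, √y}" — with the tree's matching order √y at infinity)] -/
theorem wallRightDensity_le_half (t : ℝ) : wallRightDensity t ≤ 1 / 2 :=
  (wallRightDensity_le_slope (lt_add_one t)).trans (slope_wallFreeEnergy_mem_Icc (lt_add_one t)).2

/-- **`0 ≤ ρ⁻(t) ≤ ρ⁺(t) ≤ ½` at every `t`.** [cite: BeatonBousquetMelouDeGierDuminilCopinGuttmann2014, §3.1, Proposition 5 (arXiv v5 p. 9)] -/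
theorem wallDensities_mem_Icc (t : ℝ) :
    0 ≤ wallLeftDensity t ∧ wallLeftDensity t ≤ wallRightDensity t ∧ wallRightDensity t ≤ 1 / 2 :=
  ⟨wallLeftDensity_nonneg t, wallLeftDensity_le_wallRightDensity t, wallRightDensity_le_half t⟩

/-- **Density identity at points of differentiability: if `β` is differentiable at `y = eᵗ` then
`ρ⁺(t) = y β'(y)/β(y)`** (the logarithmic derivative of WSQM's density bound `mul_deriv_wallRate_le_half`).
[cite: BeatonBousquetMelouDeGierDuminilCopinGuttmann2014, §3.1, Proposition 5 (arXiv v5 p. 9: "almost everywhere differentiable"); JansevanRensburgWhittington2013, §3.1 eq. (3.3) (arXiv v4 p. 6)] -/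
theorem wallRightDensity_eq_of_differentiableAt {t : ℝ} (hd : DifferentiableAt ℝ wallRate (Real.exp t)) :
    wallRightDensity t = Real.exp t * deriv wallRate (Real.exp t) / wallRate (Real.exp t) := by
  have h1 : HasDerivAt (fun s : ℝ => wallRate (Real.exp s)) (deriv wallRate (Real.exp t) * Real.exp t) t :=
    hd.hasDerivAt.comp t (Real.hasDerivAt_exp t)
  have h2 : HasDerivAt wallFreeEnergy ((deriv wallRate (Real.exp t) * Real.exp t) / wallRate (Real.exp t)) t := by
    have h := h1.log (wallRate_pos _).ne'
    exact h
  rw [wallRightDensity, (h2.hasDerivWithinAt (s := Set.Ioi t)).derivWithin (uniqueDiffWithinAt_Ioi t)]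
  ring

/-- **… and `ρ⁻(t) = y β'(y)/β(y)` too** (so `ρ⁻(t) = ρ⁺(t)` wherever `β` is differentiable, i.e. almost everywhere).
[cite: BeatonBousquetMelouDeGierDuminilCopinGuttmann2014, §3.1, Proposition 5 (arXiv v5 p. 9: "almost everywhere differentiable"); JansevanRensburgWhittington2013, §3.1 eq. (3.3) (arXiv v4 p. 6)] -/
theorem wallLeftDensity_eq_of_differentiableAt {t : ℝ} (hd : DifferentiableAt ℝ wallRate (Real.exp t)) :
    wallLeftDensity t = Real.exp t * deriv wallRate (Real.exp t) / wallRate (Real.exp t) := by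
  have h1 : HasDerivAt (fun s : ℝ => wallRate (Real.exp s)) (deriv wallRate (Real.exp t) * Real.exp t) t :=
    hd.hasDerivAt.comp t (Real.hasDerivAt_exp t)
  have h2 : HasDerivAt wallFreeEnergy ((deriv wallRate (Real.exp t) * Real.exp t) / wallRate (Real.exp t)) t := by
    have h := h1.log (wallRate_pos _).ne'
    exact h
  rw [wallLeftDensity, (h2.hasDerivWithinAt (s := Set.Iio t)).derivWithin (uniqueDiffWithinAt_Iio t)]
  ring

/-! #### Saturation: `κ(t) − t/2 → 0` squeezes the densities to `½` -/

/-- **`κ(t) − t/2 → 0` as `t → ∞`** (= `tendsto_log_wallRate_sub_half_log` in the variable `t = log y`).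
[cite: BeatonBousquetMelouDeGierDuminilCopinGuttmann2014, §3.1, Proposition 5 (arXiv v5 p. 9: "μ(y) ≥ max{μ, √y}"); BeatonBousquetMelouDeGierDuminilCopinGuttmann2014, §3.1 (arXiv v5 p. 10: "This translates into μ(y) ∼ √y in our honeycomb setting")] -/
theorem tendsto_wallFreeEnergy_sub_half : Tendsto (fun t : ℝ => wallFreeEnergy t - t / 2) atTop (𝓝 0) := by
  have h := tendsto_log_wallRate_sub_half_log.comp Real.tendsto_exp_atTop
  refine h.congr fun t => ?_
  simp only [Function.comp_def, wallFreeEnergy, Real.log_exp]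

/-- **`t/2 ≤ κ(t)`** at every `t` (`β(y) ≥ √y`). [cite: BeatonBousquetMelouDeGierDuminilCopinGuttmann2014, §3.1, Proposition 5 (arXiv v5 p. 9: "μ(y) ≥ max{μ, √y}")] -/
theorem half_le_wallFreeEnergy (t : ℝ) : t / 2 ≤ wallFreeEnergy t := by
  have hs : 0 < Real.sqrt (Real.exp t) := Real.sqrt_pos.2 (Real.exp_pos t)
  have h1 := one_le_wallRate_div_sqrt (Real.exp_pos t)
  rw [le_div_iff₀ hs, one_mul] at h1
  have h3 := Real.log_le_log hs h1
  rw [Real.log_sqrt (Real.exp_pos t).le, Real.log_exp] at h3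
  exact h3

/-- **`κ(t) − t/2 ≤ 72·e^{−t/2}` for `t ≥ 2 log 72`** — the tree's window `β(y) ≤ √y/(1 − 36/√y)` (`y > 36²`) in
logarithmic form, with `−log(1 − x) ≤ 2x` for `0 ≤ x ≤ ½`. [cite: BeatonBousquetMelouDeGierDuminilCopinGuttmann2014, §3.1, Proposition 5 (arXiv v5 p. 9)] -/
theorem wallFreeEnergy_sub_half_le {t : ℝ} (ht : 2 * Real.log 72 ≤ t) :
    wallFreeEnergy t - t / 2 ≤ 72 * Real.exp (-(t / 2)) := by
  set s : ℝ := Real.exp (t / 2) with hs_def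
  have hs0 : 0 < s := Real.exp_pos _
  have hs72 : 72 ≤ s := by
    have h : Real.log 72 ≤ t / 2 := by linarith
    have := Real.exp_le_exp.2 h
    rwa [Real.exp_log (by norm_num : (0 : ℝ) < 72)] at this
  have hy : Real.exp t = s ^ 2 := by rw [hs_def, sq, ← Real.exp_add]; ring_nf
  have hsqrt : Real.sqrt (Real.exp t) = s := by rw [hy, Real.sqrt_sq hs0.le]
  have hy36 : (36 : ℝ) ^ 2 < Real.exp t := by rw [hy]; nlinarith
  -- the window, in the variable `s = √y`
  have hβ : wallRate (Real.exp t) ≤ s / (1 - 36 / s) := by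
    have h := wallRate_le_sqrt_div hy36
    rwa [hsqrt] at h
  have hx1 : 36 / s ≤ 1 / 2 := by rw [div_le_iff₀ hs0]; linarith
  have hx0 : 0 < 36 / s := div_pos (by norm_num) hs0
  have h1x : 0 < 1 - 36 / s := by linarith
  have hq0 : 0 < s / (1 - 36 / s) := div_pos hs0 h1x
  -- `log β ≤ log s − log(1 − x)`
  have hlog : wallFreeEnergy t ≤ Real.log s - Real.log (1 - 36 / s) := by
    have h := Real.log_le_log (wallRate_pos _) hβ
    rw [Real.log_div hs0.ne' h1x.ne'] at h
    exact h
  have hlogs : Real.log s = t / 2 := by rw [hs_def, Real.log_exp]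
  -- `−log(1 − x) = log (1/(1−x)) ≤ 1/(1−x) − 1 = x/(1−x) ≤ 2x`
  have hneg : -Real.log (1 - 36 / s) ≤ 2 * (36 / s) := by
    have h := Real.log_le_sub_one_of_pos (inv_pos.2 h1x)
    rw [Real.log_inv] at h
    have h' : (1 - 36 / s)⁻¹ - 1 = (36 / s) / (1 - 36 / s) := by
      rw [eq_div_iff h1x.ne', sub_mul, inv_mul_cancel₀ h1x.ne', one_mul]
      ring
    rw [h'] at h
    have h'' : (36 / s) / (1 - 36 / s) ≤ 2 * (36 / s) := by
      rw [div_le_iff₀ h1x]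
      nlinarith
    linarith
  have hexp : Real.exp (-(t / 2)) = 1 / s := by rw [hs_def, Real.exp_neg, one_div]
  rw [hexp]
  have : 2 * (36 / s) = 72 * (1 / s) := by ring
  linarith

/-- **SATURATION WITH A RATE: `½ − 36e·e^{−t/2} ≤ ρ⁻(t)` for `t ≥ 2 + 2 log 72`** (in the fugacity: `½ − 36e/√y ≤ ρ⁻ ≤ ρ⁺ ≤ ½`
for `y ≥ (72e)²`) — the chord from `t − 2`, whose left end is within `72e·e^{−t/2}` of the line `t/2` that bounds `κ` below.
[cite: BeatonBousquetMelouDeGierDuminilCopinGuttmann2014, §3.1, Proposition 5 (arXiv v5 p. 9: "μ(y) ≥ max{μ, √y}"); BeatonBousquetMelouDeGierDuminilCopinGuttmann2014, §3.1 (arXiv v5 p. 10: "μ(y) ∼ √y")] -/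
theorem half_sub_le_wallLeftDensity {t : ℝ} (ht : 2 + 2 * Real.log 72 ≤ t) :
    1 / 2 - 36 * Real.exp 1 * Real.exp (-(t / 2)) ≤ wallLeftDensity t := by
  have hlt : t - 2 < t := by linarith
  refine le_trans ?_ (slope_le_wallLeftDensity hlt)
  rw [slope_def_field]
  have h1 := half_le_wallFreeEnergy t
  have h2 := wallFreeEnergy_sub_half_le (t := t - 2) (by linarith)
  have he : Real.exp (-((t - 2) / 2)) = Real.exp 1 * Real.exp (-(t / 2)) := by
    rw [← Real.exp_add]; ring_nf
  rw [he] at h2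
  rw [show t - (t - 2) = (2 : ℝ) by ring, le_div_iff₀ (by norm_num : (0 : ℝ) < 2)]
  nlinarith [Real.exp_pos 1, Real.exp_pos (-(t / 2))]

/-- **`ρ⁻(t) → ½` as `t → ∞`**: at large surface fugacity the density of adsorbed vertices of zig-zag (BBdGDCG) wall bridges saturates at
one half. [cite: BeatonBousquetMelouDeGierDuminilCopinGuttmann2014, §3.1, Proposition 5 (arXiv v5 p. 9: "μ(y) ≥ max{μ, √y}"); BeatonBousquetMelouDeGierDuminilCopinGuttmann2014, §3.1 (arXiv v5 p. 10: "μ(y) ∼ √y"); JansevanRensburgWhittington2013, §3.1 Corollary 1 / Theorem 5 (arXiv v4 p. 9: κ(a) ∼ log μ_{d−1} + log a — hypercubic analogue; density → 1 by convexity)] -/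
theorem tendsto_wallLeftDensity_atTop : Tendsto wallLeftDensity atTop (𝓝 (1 / 2)) := by
  have hexp : Tendsto (fun t : ℝ => Real.exp (-(t / 2))) atTop (𝓝 0) := by
    have h := Real.tendsto_exp_neg_atTop_nhds_zero.comp (tendsto_id.atTop_div_const (by norm_num : (0 : ℝ) < 2))
    refine h.congr fun t => ?_
    simp only [Function.comp_def, id]
  have hlow : Tendsto (fun t : ℝ => 1 / 2 - 36 * Real.exp 1 * Real.exp (-(t / 2))) atTop (𝓝 (1 / 2)) := by
    have h := (hexp.const_mul (36 * Real.exp 1)).const_sub (1 / 2)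
    rwa [mul_zero, sub_zero] at h
  refine tendsto_of_tendsto_of_tendsto_of_le_of_le' hlow tendsto_const_nhds ?_ ?_
  · filter_upwards [eventually_ge_atTop (2 + 2 * Real.log 72)] with t ht using half_sub_le_wallLeftDensity ht
  · exact Eventually.of_forall fun t => (wallLeftDensity_le_wallRightDensity t).trans (wallRightDensity_le_half t)

/-- **`ρ⁺(t) → ½` as `t → ∞`.** [cite: BeatonBousquetMelouDeGierDuminilCopinGuttmann2014, §3.1, Proposition 5 (arXiv v5 p. 9: "μ(y) ≥ max{μ, √y}"); BeatonBousquetMelouDeGierDuminilCopinGuttmann2014, §3.1 (arXiv v5 p. 10: "μ(y) ∼ √y")] -/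
theorem tendsto_wallRightDensity_atTop : Tendsto wallRightDensity atTop (𝓝 (1 / 2)) :=
  tendsto_of_tendsto_of_tendsto_of_le_of_le' tendsto_wallLeftDensity_atTop tendsto_const_nhds
    (Eventually.of_forall wallLeftDensity_le_wallRightDensity) (Eventually.of_forall wallRightDensity_le_half)

/-! #### Strictness: no chord of `κ` has slope `½`, so `β(y)/√y` is STRICTLY decreasing and the density never
reaches `½` at a finite fugacity -/

/-- **Every chord of `κ` has slope `< ½` strictly.**  If the chord over `[t, t']` had slope `½`, the three-chord inequality
would force every chord over `[t', u]` to have slope `½` as well (`≥` by convexity, `≤` by the window), so `κ(u) − u/2` would be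
constant on `[t', ∞)`, hence `0` (it tends to `0`), i.e. `β(y') = √y'` — contradicting the strict bound `√y < β(y)` of
`HexSAWSurfaceSqrtStrict.lean`. [cite: BeatonBousquetMelouDeGierDuminilCopinGuttmann2014, §3.1, Proposition 5 (arXiv v5 p. 9: "log-convex … μ(y) ≥ max{μ, √y}")] -/
theorem slope_wallFreeEnergy_lt_half {t t' : ℝ} (h : t < t') : slope wallFreeEnergy t t' < 1 / 2 := by
  refine lt_of_le_of_ne (slope_wallFreeEnergy_mem_Icc h).2 fun heq => ?_
  -- every chord to the right of `t'` has slope exactly `½`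
  have hright : ∀ u : ℝ, t' < u → wallFreeEnergy u - u / 2 = wallFreeEnergy t' - t' / 2 := by
    intro u hu
    have h1 : slope wallFreeEnergy t t' ≤ slope wallFreeEnergy t' u := by
      rw [slope_def_field, slope_def_field]
      exact convexOn_wallFreeEnergy.slope_mono_adjacent (Set.mem_univ t) (Set.mem_univ u) h hu
    have h2 := (slope_wallFreeEnergy_mem_Icc hu).2
    have hs : slope wallFreeEnergy t' u = 1 / 2 := le_antisymm h2 (heq ▸ h1)
    rw [slope_def_field, div_eq_iff (sub_pos.2 hu).ne'] at hs
    linarith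
  -- so the constant value is the limit `0`
  have hconst : Tendsto (fun u : ℝ => wallFreeEnergy u - u / 2) atTop (𝓝 (wallFreeEnergy t' - t' / 2)) := by
    refine tendsto_const_nhds.congr' ?_
    filter_upwards [eventually_gt_atTop t'] with u hu using (hright u hu).symm
  have h0 : wallFreeEnergy t' - t' / 2 = 0 := tendsto_nhds_unique hconst tendsto_wallFreeEnergy_sub_half
  -- contradiction with `√y < β(y)` at `y = e^{t'}`
  have hs0 : 0 < Real.sqrt (Real.exp t') := Real.sqrt_pos.2 (Real.exp_pos t')
  have hlog := Real.log_lt_log hs0 (sqrt_lt_wallRate (Real.exp_pos t'))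
  rw [Real.log_sqrt (Real.exp_pos t').le, Real.log_exp] at hlog
  rw [wallFreeEnergy_apply] at h0
  linarith

/-- **`κ(t') − κ(t) < (t' − t)/2` for `t < t'`.** [cite: BeatonBousquetMelouDeGierDuminilCopinGuttmann2014, §3.1, Proposition 5 (arXiv v5 p. 9)] -/
theorem wallFreeEnergy_sub_lt {t t' : ℝ} (h : t < t') : wallFreeEnergy t' - wallFreeEnergy t < (t' - t) / 2 := by
  have hs := slope_wallFreeEnergy_lt_half h
  rw [slope_def_field, div_lt_iff₀ (sub_pos.2 h)] at hs
  linarith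

/-- **STRICT chord bound: `β(y') < √(y'/y) · β(y)` for `0 < y < y'`** — the strict form of `wallRate_le_sqrt_div_mul`.
[cite: BeatonBousquetMelouDeGierDuminilCopinGuttmann2014, §3.1, Proposition 5 (arXiv v5 p. 9: "log-convex, non-decreasing function of log y … μ(y) ≥ max{μ, √y}")] -/
theorem wallRate_lt_sqrt_div_mul (hy : 0 < y) {y' : ℝ} (hyy' : y < y') : wallRate y' < Real.sqrt (y' / y) * wallRate y := by
  have hy' : 0 < y' := hy.trans hyy'
  have h := wallFreeEnergy_sub_lt (Real.log_lt_log hy hyy')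
  rw [wallFreeEnergy_apply, wallFreeEnergy_apply, Real.exp_log hy, Real.exp_log hy'] at h
  have hβ := wallRate_pos y
  have hβ' := wallRate_pos y'
  -- exponentiate: `β(y') < exp((log y' − log y)/2) · β(y) = √(y'/y) β(y)`
  have h1 : Real.log (wallRate y') < (Real.log y' - Real.log y) / 2 + Real.log (wallRate y) := by linarith
  have h2 := Real.exp_lt_exp.2 h1
  rw [Real.exp_log hβ', Real.exp_add, Real.exp_log hβ] at h2
  have h3 : Real.exp ((Real.log y' - Real.log y) / 2) = Real.sqrt (y' / y) := by
    rw [← Real.log_div hy'.ne' hy.ne', Real.sqrt_eq_rpow, Real.rpow_def_of_pos (div_pos hy' hy)]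
    ring_nf
  rwa [h3] at h2

/-- **`β(y)/√y` is STRICTLY decreasing on `(0, ∞)`** (and tends to `1`): the strict form of `antitoneOn_wallRate_div_sqrt`.
[cite: BeatonBousquetMelouDeGierDuminilCopinGuttmann2014, §3.1, Proposition 5 (arXiv v5 p. 9: "μ(y) ≥ max{μ, √y}")] -/
theorem strictAntiOn_wallRate_div_sqrt : StrictAntiOn (fun y : ℝ => wallRate y / Real.sqrt y) (Set.Ioi 0) := by
  intro y hy y' hy' hyy'
  have hy0 : (0 : ℝ) < y := hy
  have hy0' : (0 : ℝ) < y' := hy'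
  have h := wallRate_lt_sqrt_div_mul hy0 hyy'
  have hs : 0 < Real.sqrt y := Real.sqrt_pos.2 hy0
  have hs' : 0 < Real.sqrt y' := Real.sqrt_pos.2 hy0'
  show wallRate y' / Real.sqrt y' < wallRate y / Real.sqrt y
  rw [div_lt_div_iff₀ hs' hs]
  rw [Real.sqrt_div hy0'.le, div_mul_eq_mul_div, lt_div_iff₀ hs] at h
  linarith

/-- **No saturation at a finite fugacity: `ρ⁺(t) < ½` for EVERY `t`** (`ρ⁺(t) ≤` the slope of the chord over `[t, t+1]`, which is `< ½`).
[cite: BeatonBousquetMelouDeGierDuminilCopinGuttmann2014, §3.1, Proposition 5 (arXiv v5 p. 9: "log-convex … μ(y) ≥ max{μ, √y}")] -/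
theorem wallRightDensity_lt_half (t : ℝ) : wallRightDensity t < 1 / 2 :=
  (wallRightDensity_le_slope (lt_add_one t)).trans_lt (slope_wallFreeEnergy_lt_half (lt_add_one t))

/-- **`ρ⁻(t) < ½` for every `t`.** [cite: BeatonBousquetMelouDeGierDuminilCopinGuttmann2014, §3.1, Proposition 5 (arXiv v5 p. 9)] -/
theorem wallLeftDensity_lt_half (t : ℝ) : wallLeftDensity t < 1 / 2 :=
  (wallLeftDensity_le_wallRightDensity t).trans_lt (wallRightDensity_lt_half t)

end Literature.Probability.RandomPlanarGeometry.SAW.HexBW.Wall
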